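import Summits.PneNP.PneNP.Theorems.PositionalGamesParityMonotoneQuasipolyUpperCircuit
import Summits.PneNP.PneNP.Theses.PositionalGames

/-!
# `ParityMonotoneQuasipolyUpper`: parity games have quasi-polynomial MONOTONE circuits
(route PneNP/PositionalGames, support item stmt-PneNP-1298)

`Summit.PneNP.PneNP.Theses.PositionalGames.ParityMonotoneQuasipolyUpper`: there is `c` (here
`c = 14`) such that for all large `n` (here `n ≥ 3`) and EVERY parity template `(o, p, v)` on
`Fin n`, the winning-region function WIN (`ParityGame.winFn o p v`, literally the route's lambda by
`ParityGame.winFn_eq_fin`) has `circuitSizeOver monotoneBasis ≤ n ^ (c · ⌊log₂ n⌋ + c)`.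

Assembly: compress the priorities (`compress`, WIN unchanged: `winFn_compress`), run the lifting
program of `…Circuit.lean` with `H = n + 1`, `kk = ⌊log₂ n⌋ + 1`, `U` = the depth-`H` nodes of
`OrderedTree.univ kk H` (at most `2^kk · C(H + kk, kk)` of them, `OrderedTree.card_leaves_univ`),
and estimate `2 + n·N·(n·N·2n) + 2(n² + n) + 2 ≤ 3 n³ N² ≤ (3n)^(2⌊log₂ n⌋+7) ≤ n^(14⌊log₂ n⌋+14)`
with `N = |Val U| ≤ (3n)^(⌊log₂ n⌋+2)`. Sources: Jurdziński 2000 (small progress measures),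
Jurdziński–Lazić 2017 (succinct progress measures), Czerwiński et al. 2019 Thms 1–2.
-/

namespace Summit.PneNP.PneNP.Theorems.ParityLifting

set_option linter.dupNamespace false -- `Summit.PneNP.PneNP.…`: summit = sub-problem (D-0017)

open Literature.Combinatorics.Games

/-! ## Priority compression -/

section Compress

variable {n : ℕ}

/-- Compressed priorities keep parities. -/
theorem compress_mod_two (p : Fin n → ℕ) (u : Fin n) : compress p u % 2 = p u % 2 := by
  unfold compress
  omega

/-- Compressed priorities are small: `compress p u + 2 ≤ 2(n + 1)`. -/
theorem compress_add_two_le (p : Fin n → ℕ) (u : Fin n) : compress p u + 2 ≤ 2 * (n + 1) := by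
  classical
  unfold compress
  have h1 : ((Finset.univ.image p).filter fun q => q < p u).card ≤ n - 1 := by
    have hsub : ((Finset.univ.image p).filter fun q => q < p u) ⊆ (Finset.univ.image p).erase (p u) :=
      fun q hq => by
        rw [Finset.mem_filter] at hq
        exact Finset.mem_erase.2 ⟨hq.2.ne, hq.1⟩
    calc _ ≤ ((Finset.univ.image p).erase (p u)).card := Finset.card_le_card hsub
      _ = (Finset.univ.image p).card - 1 :=
          Finset.card_erase_of_mem (Finset.mem_image_of_mem p (Finset.mem_univ u))
      _ ≤ n - 1 := by
          have := Finset.card_image_le (s := (Finset.univ : Finset (Fin n))) (f := p)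
          rw [Finset.card_univ, Fintype.card_fin] at this
          omega
  have hn : 1 ≤ n := by
    have := u.2
    omega
  have h2 := Nat.mod_lt (p u) two_pos
  omega

/-- Compression is monotone along the values of `p`. -/
theorem compress_le_compress (p : Fin n → ℕ) {u w : Fin n} (h : p u ≤ p w) :
    compress p u ≤ compress p w := by
  classical
  unfold compress
  rcases h.lt_or_eq with hlt | heq
  · have hsub : insert (p u) ((Finset.univ.image p).filter fun q => q < p u) ⊆
        (Finset.univ.image p).filter fun q => q < p w := by
      intro q hq
      rw [Finset.mem_insert] at hq
      rw [Finset.mem_filter]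
      rcases hq with rfl | hq
      · exact ⟨Finset.mem_image_of_mem p (Finset.mem_univ u), hlt⟩
      · rw [Finset.mem_filter] at hq
        exact ⟨hq.1, hq.2.trans hlt⟩
    have hcard := Finset.card_le_card hsub
    rw [Finset.card_insert_of_notMem (by simp)] at hcard
    have h1 := Nat.mod_lt (p u) two_pos
    omega
  · rw [heq]

/-- The parity of the top priority on a lasso cycle is unchanged by compression. -/
theorem even_sup_compress_iff (p : Fin n → ℕ) {C : Finset (Fin n)} (hC : C.Nonempty) :
    Even (C.sup (compress p)) ↔ Even (C.sup p) := by
  obtain ⟨u, hu, hsup⟩ := Finset.exists_mem_eq_sup C hC p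
  have hsup' : C.sup (compress p) = compress p u := by
    apply le_antisymm
    · exact Finset.sup_le fun w hw => compress_le_compress p (hsup ▸ Finset.le_sup (f := p) hw)
    · exact Finset.le_sup (f := compress p) hu
  rw [hsup', hsup, Nat.even_iff, Nat.even_iff, compress_mod_two]

/-- **WIN is invariant under compression of the priorities.** -/
theorem winFn_compress (o : Fin n → Bool) (p : Fin n → ℕ) (v : Fin n) :
    ParityGame.winFn o (compress p) v = ParityGame.winFn o p v := by
  funext x
  unfold ParityGame.winFn ParityGame.EvenWinsPositional
  apply decide_eq_decide.2
  simp_rw [even_sup_compress_iff p (lassoCycle_nonempty o _ _ v)]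

end Compress

/-! ## The quasi-polynomial bound -/

section Main

open Literature.Computability.Complexity Filter

/-- The size of the value set: `|Val U| = |U| + 2`. -/
theorem card_val (U : Finset (List ℕ)) : Fintype.card (Val U) = U.card + 2 := by
  have h1 : Fintype.card (Val U) = Fintype.card (WithBot {l : List ℕ // l ∈ U}) + 1 :=
    Fintype.card_option
  have h2 : Fintype.card (WithBot {l : List ℕ // l ∈ U}) = Fintype.card {l : List ℕ // l ∈ U} + 1 :=
    Fintype.card_option
  rw [h1, h2, Fintype.card_coe]

/-- **The monotone circuit bound for one template** (`V = Fin n`, `n ≥ 3`): with labels of length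
`H = n + 1` over the depth-`H` level of the universal tree `univ (⌊log₂ n⌋ + 1) H`, the lifting
program for the compressed priorities has at most `n ^ (14 ⌊log₂ n⌋ + 14)` gates. -/
theorem circuitSizeOver_winFn_le {n : ℕ} (hn : 3 ≤ n) (o : Fin n → Bool) (p : Fin n → ℕ)
    (v : Fin n) :
    circuitSizeOver monotoneBasis (ParityGame.winFn o p v) ≤ n ^ (14 * Nat.log 2 n + 14) := by
  classical
  -- parameters
  set L := Nat.log 2 n with hL
  set H := n + 1 with hH
  set kk := L + 1 with hkk
  set T := OrderedTree.univ kk H with hT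
  set U : Finset (List ℕ) := T.nodes.filter fun l => l.length = H with hUdef
  have hU : ∀ l ∈ T.nodes, l.length = H → l ∈ U := fun l hl hlen =>
    Finset.mem_filter.2 ⟨hl, hlen⟩
  have hV : Fintype.card (Fin n) ≤ 2 ^ kk - 1 := by
    rw [Fintype.card_fin]
    have := Nat.lt_pow_succ_log_self one_lt_two n
    rw [hkk, hL]
    omega
  have hp : ∀ u, compress p u + 2 ≤ 2 * H := fun u => compress_add_two_le p u
  haveI : Nonempty (Fin n) := ⟨⟨0, by omega⟩⟩
  have hck := cktSize_winFn (U := U) o (compress p) H hp hU hV v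
  rw [winFn_compress] at hck
  refine (circuitSizeOver_le_of_cktSize01 hck).trans ?_
  -- arithmetic
  set N := Fintype.card (Val U) with hN
  rw [Fintype.card_prod, Fintype.card_fin]
  have hn0 : n ≠ 0 := by omega
  have hLn : L < n := Nat.log_lt_self 2 hn0
  have h2L : 2 ^ L ≤ n := Nat.pow_log_le_self 2 hn0
  -- N ≤ (3n)^(L+2)
  have hN2 : 2 ≤ N := by rw [hN, card_val]; omega
  have hNle : N ≤ (3 * n) ^ (L + 2) := by
    have hUcard : U.card ≤ 2 ^ kk * Nat.choose (H + kk) kk :=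
      (OrderedTree.card_filter_length_le_card_leaves T H).trans (OrderedTree.card_leaves_univ kk H)
    have hch : Nat.choose (H + kk) kk ≤ (3 * n) ^ (L + 1) :=
      (Nat.choose_add_le_add_one_pow H kk).trans (Nat.pow_le_pow_left (by omega) _)
    have hX : 1 ≤ (3 * n) ^ (L + 1) := Nat.one_le_pow _ _ (by omega)
    calc N = U.card + 2 := by rw [hN, card_val]
      _ ≤ 2 ^ kk * (3 * n) ^ (L + 1) + 2 := by
          have := Nat.mul_le_mul (le_refl (2 ^ kk)) hch
          omega
      _ ≤ 2 * n * (3 * n) ^ (L + 1) + n * (3 * n) ^ (L + 1) := by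
          have h1 : 2 ^ kk ≤ 2 * n := by rw [hkk, pow_succ]; omega
          have h2 := Nat.mul_le_mul h1 (le_refl ((3 * n) ^ (L + 1)))
          have h3 : 2 ≤ n * (3 * n) ^ (L + 1) := by nlinarith
          omega
      _ = (3 * n) ^ (L + 2) := by ring
  -- the gate count is at most 3 n³ N²
  have hS : 2 + n * N * (n * N * (n + n)) + (2 * (n * n + n) + 2) ≤ 3 * n ^ 3 * N ^ 2 := by
    have h1 : n * N * (n * N * (n + n)) = 2 * n ^ 3 * N ^ 2 := by ring
    have h2 : 4 ≤ N ^ 2 := by nlinarith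
    have h3 : 2 * (n * n + n) + 4 ≤ 4 * n ^ 3 := by nlinarith
    have h4 : 4 * n ^ 3 ≤ n ^ 3 * N ^ 2 := by nlinarith
    nlinarith
  refine hS.trans ?_
  calc 3 * n ^ 3 * N ^ 2 ≤ (3 * n) ^ 3 * ((3 * n) ^ (L + 2)) ^ 2 := by
        have h1 : 3 * n ^ 3 ≤ (3 * n) ^ 3 := by nlinarith
        have h2 : N ^ 2 ≤ ((3 * n) ^ (L + 2)) ^ 2 := Nat.pow_le_pow_left hNle 2
        exact Nat.mul_le_mul h1 h2
    _ = (3 * n) ^ (2 * L + 7) := by ring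
    _ ≤ (n ^ 2) ^ (2 * L + 7) := Nat.pow_le_pow_left (by nlinarith) _
    _ = n ^ (4 * L + 14) := by ring
    _ ≤ n ^ (14 * L + 14) := Nat.pow_le_pow_right (by omega) (by omega)

end Main

end ParityLifting

set_option linter.dupNamespace false in -- `Summit.PneNP.PneNP.…`: summit = sub-problem (D-0017)
/-- **`ParityMonotoneQuasipolyUpper` holds** (route PneNP/PositionalGames, item stmt-PneNP-1298):
the winning-region function of every parity template on `Fin n` has monotone circuit complexity
at most `n ^ (14 ⌊log₂ n⌋ + 14)` for all `n ≥ 3` — unrolled progress-measure lifting over a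
quasi-polynomial universal tree (Jurdziński 2000; Jurdziński–Lazić 2017; Czerwiński et al. 2019,
Thms 1–2). -/
theorem ParityMonotoneQuasipolyUpper_proof :
    Summit.PneNP.PneNP.Theses.PositionalGames.ParityMonotoneQuasipolyUpper := by
  refine ⟨14, Filter.eventually_atTop.2 ⟨3, fun n hn o p v => ?_⟩⟩
  rw [← Literature.Combinatorics.Games.ParityGame.winFn_eq_fin n o p v]
  exact ParityLifting.circuitSizeOver_winFn_le hn o p v

end Summit.PneNP.PneNP.Theorems
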